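import Summits.KontsevichZagierPeriods.KontsevichZagierPeriods.Theorems.UnfoldedStokesStokesGenerationFibrewiseClosure
import Summits.KontsevichZagierPeriods.KontsevichZagierPeriods.Theorems.UnfoldedStokesStokesGenerationFibrewiseClosureAdd
import Summits.KontsevichZagierPeriods.KontsevichZagierPeriods.Theorems.UnfoldedStokesStokesGenerationFibrewiseClosureSmul

/-!
# `StokesGeneration` (stmt-KontsevichZagierPeriods-3586), line `fibrewise_stokes` — closure properties of the S2 class, III: differences and finite sums

The class `FibStokesDecomposable M h` (route definition, `Theorems/UnfoldedStokesDefs.lean`) is an additive subgroup of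
the functions on `ℝ^M` and a module over the real algebraic numbers: zero (`fibStokesDecomposable_zero`), negation and
coordinate permutations (file I), sums (`fibStokesDecomposable_add`), algebraic scalars (file II); here the derived
forms used by sector assemblies — differences and finite sums (`Finset` induction). Pure bookkeeping.

References: J. Ayoub, Ann. of Math. 181 (2015), Rem. 1.5; M. Kontsevich, D. Zagier, *Periods* (2001), §1.2.
-/

noncomputable section

set_option linter.dupNamespace false

namespace Summit.KontsevichZagierPeriods.KontsevichZagierPeriods.Cruxes.StokesGeneration.FibrewiseStokes

open MeasureTheory Set
open Literature.NumberTheory.Transcendental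
open Literature.NumberTheory.Transcendental.KZ

/-- **Differences (registered stub `fibStokesDecomposable_sub`).** [folklore] -/
theorem fibStokesDecomposable_sub : ∀ (M : ℕ) (h₁ h₂ : (Fin M → ℝ) → ℝ), FibStokesDecomposable M h₁ → FibStokesDecomposable M h₂ → FibStokesDecomposable M (fun x => h₁ x - h₂ x) := by
  intro M h₁ h₂ H₁ H₂
  have hfun : (fun x => h₁ x - h₂ x) = fun x => h₁ x + -h₂ x := funext fun x => sub_eq_add_neg _ _
  rw [hfun]
  exact fibStokesDecomposable_add M h₁ (fun x => -h₂ x) H₁ (fibStokesDecomposable_neg M h₂ H₂)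

/-- **Finite sums.** A finite sum of fibrewise-Stokes decomposable functions is decomposable. [folklore] -/
theorem fibStokesDecomposable_finsetSum {M : ℕ} {ι : Type*} (s : Finset ι) (f : ι → (Fin M → ℝ) → ℝ)
    (hf : ∀ i ∈ s, FibStokesDecomposable M (f i)) : FibStokesDecomposable M (fun x => ∑ i ∈ s, f i x) := by
  classical
  induction s using Finset.induction_on with
  | empty =>
    simpa using fibStokesDecomposable_zero M
  | insert a s ha ih =>
    have hfun : (fun x => ∑ i ∈ insert a s, f i x) = fun x => f a x + ∑ i ∈ s, f i x :=
      funext fun x => Finset.sum_insert ha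
    rw [hfun]
    exact fibStokesDecomposable_add M (f a) _ (hf a (Finset.mem_insert_self a s))
      (ih fun i hi => hf i (Finset.mem_insert_of_mem hi))

/-- **Integer combinations.** `ℤ`-linear combinations of decomposable functions are decomposable (the shape in which
Baker-type reductions deliver their certificates). [folklore] -/
theorem fibStokesDecomposable_zsmul_sum {M : ℕ} {ι : Type*} (s : Finset ι) (n : ι → ℤ)
    (f : ι → (Fin M → ℝ) → ℝ) (hf : ∀ i ∈ s, FibStokesDecomposable M (f i)) :
    FibStokesDecomposable M (fun x => ∑ i ∈ s, (n i : ℝ) * f i x) :=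
  fibStokesDecomposable_finsetSum s (fun i x => (n i : ℝ) * f i x) fun i hi =>
    fibStokesDecomposable_const_mul M (n i : ℝ) (f i) (isAlgebraic_int (n i)) (hf i hi)

end Summit.KontsevichZagierPeriods.KontsevichZagierPeriods.Cruxes.StokesGeneration.FibrewiseStokes

end
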